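import Literature.Barriers.AtomisticToContinuum.DisorderedHarmonicChainTransfer
import Mathlib.Analysis.SpecialFunctions.Trigonometric.Inverse
import Mathlib.Analysis.SpecialFunctions.Trigonometric.Arctan
import Mathlib.Analysis.SpecialFunctions.Trigonometric.Bounds
import Mathlib.Analysis.Real.Pi.Bounds
import HarnessLib

/-!
# Ajanki–Huveneers 2011, §3–§5: the phase chain on the circle, the exact representation of `D_n(v)`, and the facts feeding the bounds of §6

Fourth file of the Casher–Lebowitz / Ajanki–Huveneers cluster (`DisorderedHarmonicChain.lean`,
`…Spectral.lean`, `…Transfer.lean`; provefact unit for `AjankiHuveneers2011_spectralScaling`,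
SIZE XL). `…Transfer.lean` reduced Theorem 1.1 to three bounds (U), (H), (L) on the mass-averaged
current density `𝔼 j_n`; (U) and (L) are proved in §6 of the paper from the representation of
§3, the large-deviation bound of §4 and the potential theory of §5. This file vendors that layer
(O. Ajanki, F. Huveneers, CMP **301** (2011) 841–883, arXiv:1003.1076):

* **§3.1 DEFINED and its algebra PROVED.** The mean shift `ϑ(w) = π⁻¹ arccos(1 - π²w²/2)` (3.4)
  (`ahTheta`; `cos πϑ = 1 - π²w²/2`, `sin πϑ = πw√(1 - (πw/2)²)`, `w ≤ ϑ ≤ w + w³`), the phase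
  correction `Φ(x,b)` of (3.10) (`ahPhi`), the lifted one-step map `f_b(x) = x + ϑ + Φ(x,b)` (3.8)
  (`ahStep`), the phase chain `X^x_n = f_{B_n}(X^x_{n-1})`, `X^x_0 = x` of Def. 3.3 on `ℝ`
  (`ahPhase`), the amplitude `Γ^x_n = ∏_{l=1}^{n-1} sin πX_l / sin π(X_l + Φ(X_l, B_{l+1}))` of
  (3.14)/(3.20) (`ahGamma`, factors continuously extended by `1` where `sin πX_l = 0`), the
  functions `s`, `r` of (3.21). PROVED: Lemma 3.1 (`ahShift_identity`: conjugating the mean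
  transfer matrix gives the shift by `ϑ`), Lemma 3.2 in exact projective form
  (`ahStep_identity`: `A(b) u(x) ∥ u(f_b(x))` for `u(x) = (sin πx, sin π(x - ϑ))`, the formula
  (3.10) for `Φ` being exactly what makes this true), Prop. 3.5 as the exact division-free
  identity `D_n(u(x)) · ∏_{l<n} sin π(X_l + Φ(X_l,B_{l+1})) = sin πX_n · ∏_{l<n} sin πX_l`
  (`ahD_product_formula`), and Cor. 3.6 for `D_n(e₁)` (start `x = ϑ`) and `D_n(e₂)` (start
  `x = 0`, via `D_{n+1}(e₂) = -θ_*D_n(e₁)` and `X^0_{l+1} = θ_*X^ϑ_l`)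
  (`ahD_e₁_product_formula`, `ahD_e₂_product_formula`).
* **NAMED FACTS** (to be discharged bottom-up): the expansion (3.11) of `Φ`
  (`AjankiHuveneers2011_PhiExpansion`), Cor. 3.4 (i) (`…_phaseMonotone`), the exponential
  representation (3.21) of `Γ` (`…_logGammaExpansion`), Prop. 4.1 `sup_x 𝔼(1/Γ^x_n) ≲ e^{-αw²n}`
  (`…_invGammaDecay`) and Prop. 5.1, the two-sided potential-theory estimate for
  `𝔼(e^{w∑h(X_{k-1})B_k} u(X_n))` (`…_potentialTheory`), all over the reduced law
  `ReducedLawHyp` of §2.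

## Sources

* O. Ajanki, F. Huveneers, CMP 301 (2011) 841–883, arXiv:1003.1076: §2 (reduced masses `B_k`,
  `A_k(w)`), §2.1 (2.2)–(2.3), §3.1 Lemma 3.1 (3.3)–(3.7), Lemma 3.2 (3.8)–(3.11), Def. 3.3,
  (3.15)–(3.16), Cor. 3.4, Prop. 3.5 (3.14), (3.17)–(3.21), Cor. 3.6 (3.22)–(3.23), §4 Prop. 4.1,
  §5 Prop. 5.1.

## Design notes

* Variables: everything here is in the paper's variables — rescaled frequency `w`, reduced
  masses `b`, transfer matrix `A(b) = [[2 - π²w²(1+b), -1],[1,0]]` (`ahDiag`); `D_n(v)` is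
  `ahD (ahDiag w B)` of `…Transfer.lean` (`B k` is the paper's `B_{k+1}`). The bridge to the
  physical masses/frequency of `clCurrentDensity` (`m_k = 𝔼M(1+B_k)`, `ω = πw/√𝔼M`, a fixed
  positive rescaling) belongs to the derivation of (U)/(L), not here.
* The coordinate `g` is `g(x) = sin πx / sin π(x - ϑ)` (from (3.12)–(3.14); the closed form
  printed in (3.6) has `+ sin πϑ` in the denominator, a sign misprint: with `-` it inverts (3.7)
  and matches (3.13)); we never use `g` itself but its projective version `u(x)`, which avoids
  the point at infinity and all divisions.
* `ahPhase` is the LIFT of the chain to `ℝ` ("Let us treat `X^x`, `x ∈ ℝ` as real valued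
  processes", Lemma 3.7): `f_b(x) - x = ϑ + Φ ∈ (0, 2w)` for small `w`, so winding is canonical.
* Cor. 3.6 is stated exactly: `D_n(e₁) ∏_{l<n} sin π(X_l+Φ_l) = sin πX_n ∏_{1≤l<n} sin πX_l`
  (so `D_n(e₁) = Γ^ϑ_n sin πX^ϑ_n / sin π[ϑ + Φ(ϑ,B_1)]`, (3.22), off the null set where a factor
  vanishes), and `-D_n(e₂) ∏_{1≤l<n} sin π(X^0_l+Φ_l) = sin πX^0_n ∏_{2≤l<n} sin πX^0_l`, i.e.
  `D_n(e₂) = -Γ^0_n sin πX^0_n / sin πϑ`; the display (3.23) prints this without the sign and with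
  `sin π[ϑ + Φ(ϑ,B_2)]` (`= sin πϑ · (1 + 𝒪(w))`) in the denominator — immaterial at the `∼` level
  at which (3.23) is used, but the identities here are the exact ones (checked numerically).
* (3.21) is vendored for the product (3.14) that defines `Γ^x_n`, i.e. with the sum over the
  same factors `l = 1,…,n-1`; see the docstring of `AjankiHuveneers2011_logGammaExpansion`.
* NOT here: Cor. 3.4 (ii)–(iii), Lemma 3.7 and Lemma 6.1 (inputs of (L) only), Lemmas 4.2–4.4
  (Freedman/Azuma, noisy ergodicity: inputs of Prop. 4.1), the operators `T`, `T_y`, `S_{y,n}`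
  of §5, and the derivations (U) ← {Cor. 3.6, (3.21), Cor. 3.4(i), Prop. 4.1, Prop. 5.1},
  (L) ← {Cor. 3.6, Lemma 3.7, Prop. 5.1, Lemma 6.1} of §6 — the next sessions of this unit.
-/

noncomputable section

open MeasureTheory Finset Real

namespace Literature.Barriers.AtomisticToContinuum.HeatConduction

/-! ### The coordinates of §3.1 -/

/-- The mean shift `ϑ(w) = π⁻¹ arccos(1 - π²w²/2)` (`= w + 𝒪(w³)`): the rotation number of
the mean transfer matrix `𝔼A = [[2 - π²w², -1],[1,0]]`, `2 - π²w² = 2cos πϑ`.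
[cite: AjankiHuveneers2011, Lemma 3.1 eq. (3.4)] -/
def ahTheta (w : ℝ) : ℝ := Real.arccos (1 - π ^ 2 * w ^ 2 / 2) / π

/-- The denominator `√(1 - (πw/2)²) - (πw/2) sin(2πx) b` inside the `arctan` of (3.10).
[cite: AjankiHuveneers2011, Lemma 3.2 eq. (3.10)] -/
def ahDen (w x b : ℝ) : ℝ := Real.sqrt (1 - (π * w / 2) ^ 2) - (π * w / 2) * Real.sin (2 * π * x) * b

/-- The numerator `(πw/2)[1 - cos(2πx)] b` inside the `arctan` of (3.10).
[cite: AjankiHuveneers2011, Lemma 3.2 eq. (3.10)] -/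
def ahNum (w x b : ℝ) : ℝ := (π * w / 2) * (1 - Real.cos (2 * π * x)) * b

/-- **The phase correction `Φ(x, b)`** of the random step:
`Φ(x,b) = π⁻¹ arctan{ (πw/2)[1 - cos 2πx] b / (√(1 - (πw/2)²) - (πw/2) sin(2πx) b) }`,
`1`-periodic in `x`, values in `(-1/2, 1/2)`, `Φ(x, 0) = Φ(0, b) = 0`.
[cite: AjankiHuveneers2011, Lemma 3.2 eq. (3.10)] -/
def ahPhi (w x b : ℝ) : ℝ := Real.arctan (ahNum w x b / ahDen w x b) / π

/-- **The one-step map `f_b(x) = x + ϑ + Φ(x, b)`** (`= g ∘ 𝓜_{A(b)} ∘ g⁻¹` on `𝕋`), here as its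
canonical lift to `ℝ`. [cite: AjankiHuveneers2011, Lemma 3.2 eq. (3.8)] -/
def ahStep (w b x : ℝ) : ℝ := x + ahTheta w + ahPhi w x b

/-- **The phase chain `X^x`** (Def. 3.3): `X^x_0 = x`, `X^x_n = f_{B_n}(X^x_{n-1})`, lifted to `ℝ`;
the disorder is `B : ℕ → ℝ` with `B k` the paper's `B_{k+1}`.
[cite: AjankiHuveneers2011, Def. 3.3 eq. (3.12)] -/
def ahPhase (w x : ℝ) (B : ℕ → ℝ) : ℕ → ℝ
  | 0 => x
  | n + 1 => ahStep w (B n) (ahPhase w x B n)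

/-- One factor `sin πx / sin π(x + Φ(x,b))` of the amplitude (3.14) (`= e^{ws(x)b + w²r(x)b² + 𝒪(w³)}`,
(3.19)), continuously extended by its limit `1` where `sin πx = 0` (there `Φ(x,b) = 0`).
[cite: AjankiHuveneers2011, Prop. 3.5 eqs. (3.14), (3.17)-(3.19)] -/
def ahFactor (w x b : ℝ) : ℝ :=
  if Real.sin (π * x) = 0 then 1 else Real.sin (π * x) / Real.sin (π * (x + ahPhi w x b))

/-- **The amplitude `Γ^x_n = ∏_{l=1}^{n-1} sin πX^x_l / sin π(X^x_l + Φ(X^x_l, B_{l+1}))`** of the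
representation `D_n(v) = v₀ Γ^x_n sin πX^x_n / sin π[x + Φ(x, B_1)]` (the product of (3.14);
`n - 1` factors, empty for `n ≤ 1`). [cite: AjankiHuveneers2011, Prop. 3.5 eqs. (3.14), (3.20)] -/
def ahGamma (w x : ℝ) (B : ℕ → ℝ) (n : ℕ) : ℝ :=
  ∏ l ∈ Finset.Ico 1 n, ahFactor w (ahPhase w x B l) (B l)

/-- The diagonal symbol `2 - π²w²(1 + B_{k+1})` of the transfer matrices
`A_k = [[2 - π²w²(1+B_k), -1],[1,0]]` in the paper's variables, so that `D_n(v)` of (2.2) is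
`ahD (ahDiag w B) v₀ v₋₁ n`. [cite: AjankiHuveneers2011, §2 eq. (2.1) and §2.1 eq. (2.2)] -/
def ahDiag (w : ℝ) (B : ℕ → ℝ) (k : ℕ) : ℝ := 2 - π ^ 2 * w ^ 2 * (1 + B k)

/-- `s(x) = -(π/2) sin 2πx`, the first-order exponent of the amplitude. [cite: AjankiHuveneers2011, Prop. 3.5 eq. (3.21)] -/
def ahS (x : ℝ) : ℝ := -(π / 2) * Real.sin (2 * π * x)

/-- `r(x) = (π²/4)(cos² 2πx - cos 2πx)`, the second-order exponent of the amplitude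
(`∫_𝕋 r = π²/8`, the Lyapunov exponent `γ(w) = 𝔼(B²)∫r · w² + 𝒪(w³)`, (4.2)).
[cite: AjankiHuveneers2011, Prop. 3.5 eq. (3.21)] -/
def ahR (x : ℝ) : ℝ := π ^ 2 / 4 * (Real.cos (2 * π * x) ^ 2 - Real.cos (2 * π * x))

/-- `X^x_0 = x`. [cite: AjankiHuveneers2011, Def. 3.3 eq. (3.12)] -/
@[simp] theorem ahPhase_zero (w x : ℝ) (B : ℕ → ℝ) : ahPhase w x B 0 = x := rfl

/-- `X^x_{n+1} = f_{B_{n+1}}(X^x_n)`. [cite: AjankiHuveneers2011, Def. 3.3 eq. (3.12)] -/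
theorem ahPhase_succ (w x : ℝ) (B : ℕ → ℝ) (n : ℕ) :
    ahPhase w x B (n + 1) = ahStep w (B n) (ahPhase w x B n) := rfl

/-! ### Exact trigonometry: `cos πϑ`, `sin πϑ`, Lemma 3.1, Lemma 3.2 -/

/-- `πϑ = arccos(1 - π²w²/2)`. [cite: AjankiHuveneers2011, Lemma 3.1 eq. (3.4)] -/
theorem pi_mul_ahTheta (w : ℝ) : π * ahTheta w = Real.arccos (1 - π ^ 2 * w ^ 2 / 2) := by
  unfold ahTheta
  field_simp

/-- `cos πϑ = 1 - π²w²/2`, i.e. `2 - π²w² = 2cos πϑ = tr 𝔼A` (`|πw| ≤ 2`).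
[cite: AjankiHuveneers2011, Lemma 3.1 eqs. (3.4)-(3.5)] -/
theorem cos_pi_mul_ahTheta {w : ℝ} (hw : π * w ≤ 2) (hw' : -2 ≤ π * w) :
    Real.cos (π * ahTheta w) = 1 - π ^ 2 * w ^ 2 / 2 := by
  rw [pi_mul_ahTheta]
  apply Real.cos_arccos
  · nlinarith [sq_nonneg (π * w)]
  · nlinarith [sq_nonneg (π * w)]

/-- `sin πϑ = πw √(1 - (πw/2)²)` (`w ≥ 0`). [cite: AjankiHuveneers2011, Lemma 3.1 eq. (3.4)] -/
theorem sin_pi_mul_ahTheta {w : ℝ} (hw0 : 0 ≤ w) :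
    Real.sin (π * ahTheta w) = π * w * Real.sqrt (1 - (π * w / 2) ^ 2) := by
  rw [pi_mul_ahTheta, Real.sin_arccos]
  have h1 : 1 - (1 - π ^ 2 * w ^ 2 / 2) ^ 2 = (π * w) ^ 2 * (1 - (π * w / 2) ^ 2) := by ring
  rw [h1, Real.sqrt_mul (sq_nonneg _), Real.sqrt_sq (by positivity)]

/-- **Lemma 3.1 (the mean evolution is the shift by `ϑ`)** in projective form: with
`u(x) = (sin πx, sin π(x - ϑ))`, `𝔼A · u(x) = u(x + ϑ)`; first component:
`(2 - π²w²) sin πx - sin π(x - ϑ) = sin π(x + ϑ)` (the second is tautological).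
[cite: AjankiHuveneers2011, Lemma 3.1 eq. (3.3)] -/
theorem ahShift_identity {w : ℝ} (hw : π * w ≤ 2) (hw' : -2 ≤ π * w) (x : ℝ) :
    (2 - π ^ 2 * w ^ 2) * Real.sin (π * x) - Real.sin (π * (x - ahTheta w)) =
      Real.sin (π * (x + ahTheta w)) := by
  have hc := cos_pi_mul_ahTheta hw hw'
  rw [mul_sub, mul_add, Real.sin_sub, Real.sin_add]
  linear_combination (2 * Real.sin (π * x)) * hc.symm

/-- The denominator of (3.10) is positive as soon as `(πw/2)(1 + |b|) < 1`. [folklore] -/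
theorem ahDen_pos {w x b : ℝ} (hw0 : 0 ≤ w) (hwb : π * w / 2 * (1 + |b|) < 1) : 0 < ahDen w x b := by
  unfold ahDen
  set t := π * w / 2 with ht
  have ht0 : 0 ≤ t := by positivity
  have htb : t * |b| < 1 - t := by nlinarith
  have ht1 : t < 1 := by nlinarith [abs_nonneg b]
  have hs : |Real.sin (2 * π * x) * b| ≤ |b| := by
    rw [abs_mul]
    exact mul_le_of_le_one_left (abs_nonneg b) (Real.abs_sin_le_one _)
  have h2 : t * Real.sin (2 * π * x) * b ≤ t * |b| := by
    rw [mul_assoc]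
    exact (le_abs_self _).trans (by rw [abs_mul, abs_of_nonneg ht0]; exact mul_le_mul_of_nonneg_left hs ht0)
  have h3 : 1 - t ≤ Real.sqrt (1 - t ^ 2) := by
    rw [Real.le_sqrt (by linarith) (by nlinarith)]
    nlinarith
  linarith

/-- **Lemma 3.2 (`f_b = g ∘ 𝓜_{A(b)} ∘ g⁻¹`)** in exact projective form: with
`u(x) = (sin πx, sin π(x - ϑ))`, `A(b) u(x)` is parallel to `u(f_b(x))`, precisely
`sin π(x + Φ(x,b)) · [(2 - π²w²(1+b)) sin πx - sin π(x - ϑ)] = sin πx · sin π f_b(x)` (and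
trivially `sin π(x + Φ) · sin πx = sin πx · sin π(f_b(x) - ϑ)`), for `w ≥ 0`,
`(πw/2)(1 + |b|) < 1`. The proof is the computation that (3.10) solves
`tan πΦ · (sin πϑ - π²w²b sin πx cos πx) = π²w²b sin²πx`.
[cite: AjankiHuveneers2011, Lemma 3.2 eqs. (3.8)-(3.10)] -/
theorem ahStep_identity {w x b : ℝ} (hw0 : 0 ≤ w) (hwb : π * w / 2 * (1 + |b|) < 1) :
    Real.sin (π * (x + ahPhi w x b)) *
        ((2 - π ^ 2 * w ^ 2 * (1 + b)) * Real.sin (π * x) - Real.sin (π * (x - ahTheta w))) =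
      Real.sin (π * x) * Real.sin (π * ahStep w b x) := by
  have hD := ahDen_pos (x := x) hw0 hwb
  have ht1 : π * w / 2 < 1 := by nlinarith [abs_nonneg b, Real.pi_pos]
  have hw2 : π * w ≤ 2 := by linarith
  have hw2' : -2 ≤ π * w := by nlinarith [Real.pi_pos]
  have hc := cos_pi_mul_ahTheta hw2 hw2'
  have hs := sin_pi_mul_ahTheta (w := w) hw0
  set q := Real.sqrt (1 - (π * w / 2) ^ 2) with hq
  -- the defining relation of Φ: sin(πΦ) · D = cos(πΦ) · N
  have hΦ : π * ahPhi w x b = Real.arctan (ahNum w x b / ahDen w x b) := by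
    unfold ahPhi; field_simp
  have hrel : Real.sin (π * ahPhi w x b) * ahDen w x b = Real.cos (π * ahPhi w x b) * ahNum w x b := by
    rw [hΦ, Real.sin_arctan, Real.cos_arctan]
    field_simp
  have hN : ahNum w x b = π * w * b * Real.sin (π * x) ^ 2 := by
    unfold ahNum
    rw [show 2 * π * x = 2 * (π * x) by ring, Real.cos_two_mul, Real.cos_sq']
    ring
  have hDf : ahDen w x b = q - π * w * b * Real.sin (π * x) * Real.cos (π * x) := by
    unfold ahDen
    rw [show 2 * π * x = 2 * (π * x) by ring, Real.sin_two_mul]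
    ring
  rw [hN, hDf] at hrel
  have hpy := Real.sin_sq_add_cos_sq (π * x)
  unfold ahStep
  rw [show π * (x + ahPhi w x b) = π * x + π * ahPhi w x b by ring,
    show π * (x + ahTheta w + ahPhi w x b) = π * x + π * ahTheta w + π * ahPhi w x b by ring,
    show π * (x - ahTheta w) = π * x - π * ahTheta w by ring,
    Real.sin_sub]
  simp only [Real.sin_add, Real.cos_add]
  rw [hc, hs]
  linear_combination (π * w) * hrel + (π * w * q * Real.sin (π * ahPhi w x b)) * hpy

/-! ### Prop 3.5 (exact): the product representation -/

/-- The previous matrix element `D_{n-1}(v)`, with `D_{-1}(v) = v₋₁`. [cite: AjankiHuveneers2011, §2.1 eq. (2.2)] -/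
def ahDprev (d : ℕ → ℝ) (v₀ v₁ : ℝ) : ℕ → ℝ
  | 0 => v₁
  | n + 1 => ahD d v₀ v₁ n

/-- `D_{n+1} = d_{n+1} D_n - D_{n-1}` uniformly in `n ≥ 0`. [cite: AjankiHuveneers2011, §2.1 eq. (2.2)] -/
theorem ahD_succ_eq (d : ℕ → ℝ) (v₀ v₁ : ℝ) (n : ℕ) :
    ahD d v₀ v₁ (n + 1) = d n * ahD d v₀ v₁ n - ahDprev d v₀ v₁ n := by
  cases n <;> rfl

/-- Unfolding `ahDiag`. [cite: AjankiHuveneers2011, §2 eq. (2.1)] -/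
theorem ahDiag_apply (w : ℝ) (B : ℕ → ℝ) (k : ℕ) : ahDiag w B k = 2 - π ^ 2 * w ^ 2 * (1 + B k) := rfl

/-- **Prop. 3.5, exact division-free form**: for the initial vector `v = u(x) = (sin πx, sin π(x-ϑ))`,
`D_n(v) · ∏_{l<n} sin π(X^x_l + Φ(X^x_l, B_{l+1})) = sin πX^x_n · ∏_{l<n} sin πX^x_l` and the same for
`D_{n-1}(v)` with `sin π(X^x_n - ϑ)` — the telescoping product (3.14)
`D_n/v₀ = ∏_{l=1}^n sin πX_l / sin π(X_l - ϑ)` cleared of denominators (induction on `n` with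
`ahStep_identity`). Hypotheses: `w ≥ 0` and `(πw/2)(1 + |B_k|) < 1` for all `k`.
[cite: AjankiHuveneers2011, Prop. 3.5 eqs. (3.14), (3.20)] -/
theorem ahD_product_formula {w x : ℝ} {B : ℕ → ℝ} (hw0 : 0 ≤ w)
    (hwB : ∀ k, π * w / 2 * (1 + |B k|) < 1) :
    ∀ n, ahD (ahDiag w B) (Real.sin (π * x)) (Real.sin (π * (x - ahTheta w))) n *
        ∏ l ∈ Finset.range n, Real.sin (π * (ahPhase w x B l + ahPhi w (ahPhase w x B l) (B l))) =
      Real.sin (π * ahPhase w x B n) * ∏ l ∈ Finset.range n, Real.sin (π * ahPhase w x B l) ∧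
    ahDprev (ahDiag w B) (Real.sin (π * x)) (Real.sin (π * (x - ahTheta w))) n *
        ∏ l ∈ Finset.range n, Real.sin (π * (ahPhase w x B l + ahPhi w (ahPhase w x B l) (B l))) =
      Real.sin (π * (ahPhase w x B n - ahTheta w)) * ∏ l ∈ Finset.range n, Real.sin (π * ahPhase w x B l)
  | 0 => by simp [ahDprev]
  | n + 1 => by
    obtain ⟨ih1, ih2⟩ := ahD_product_formula hw0 hwB n
    have hstep := ahStep_identity (x := ahPhase w x B n) hw0 (hwB n)
    set X := ahPhase w x B n with hX
    set a := ahD (ahDiag w B) (Real.sin (π * x)) (Real.sin (π * (x - ahTheta w))) n with ha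
    set p := ahDprev (ahDiag w B) (Real.sin (π * x)) (Real.sin (π * (x - ahTheta w))) n with hp
    set P := ∏ l ∈ Finset.range n, Real.sin (π * ahPhase w x B l) with hP
    set Q := ∏ l ∈ Finset.range n,
      Real.sin (π * (ahPhase w x B l + ahPhi w (ahPhase w x B l) (B l))) with hQ
    rw [Finset.prod_range_succ, Finset.prod_range_succ, ahPhase_succ, ← hX]
    constructor
    · rw [ahD_succ_eq, ← ha, ← hp, ahDiag_apply]
      calc ((2 - π ^ 2 * w ^ 2 * (1 + B n)) * a - p) * (Q * Real.sin (π * (X + ahPhi w X (B n))))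
          = ((2 - π ^ 2 * w ^ 2 * (1 + B n)) * (a * Q) - p * Q) *
              Real.sin (π * (X + ahPhi w X (B n))) := by ring
        _ = ((2 - π ^ 2 * w ^ 2 * (1 + B n)) * (Real.sin (π * X) * P) -
              Real.sin (π * (X - ahTheta w)) * P) * Real.sin (π * (X + ahPhi w X (B n))) := by
            rw [ih1, ih2]
        _ = P * (Real.sin (π * (X + ahPhi w X (B n))) *
              ((2 - π ^ 2 * w ^ 2 * (1 + B n)) * Real.sin (π * X) - Real.sin (π * (X - ahTheta w)))) := by
            ring
        _ = P * (Real.sin (π * X) * Real.sin (π * ahStep w (B n) X)) := by rw [hstep]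
        _ = Real.sin (π * ahStep w (B n) X) * (P * Real.sin (π * X)) := by ring
    · show a * (Q * Real.sin (π * (X + ahPhi w X (B n)))) =
        Real.sin (π * (ahStep w (B n) X - ahTheta w)) * (P * Real.sin (π * X))
      rw [show ahStep w (B n) X - ahTheta w = X + ahPhi w X (B n) by unfold ahStep; ring]
      calc a * (Q * Real.sin (π * (X + ahPhi w X (B n))))
          = (a * Q) * Real.sin (π * (X + ahPhi w X (B n))) := by ring
        _ = Real.sin (π * X) * P * Real.sin (π * (X + ahPhi w X (B n))) := by rw [ih1]
        _ = Real.sin (π * (X + ahPhi w X (B n))) * (P * Real.sin (π * X)) := by ring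

/-! ### Cor 3.6 (exact) -/

/-- `ϑ > 0` for `w > 0`. [cite: AjankiHuveneers2011, Lemma 3.1 eq. (3.4)] -/
theorem ahTheta_pos {w : ℝ} (hw0 : 0 < w) : 0 < ahTheta w := by
  unfold ahTheta
  refine div_pos (Real.arccos_pos.mpr ?_) Real.pi_pos
  nlinarith [Real.pi_pos, mul_pos Real.pi_pos hw0]

/-- `ϑ ≤ 1/2` for `π²w² ≤ 2`. [cite: AjankiHuveneers2011, Lemma 3.1 eq. (3.4)] -/
theorem ahTheta_le_half {w : ℝ} (hw : π ^ 2 * w ^ 2 ≤ 2) : ahTheta w ≤ 1 / 2 := by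
  unfold ahTheta
  rw [div_le_iff₀ Real.pi_pos]
  have := Real.arccos_le_pi_div_two.mpr (show (0 : ℝ) ≤ 1 - π ^ 2 * w ^ 2 / 2 by linarith)
  linarith

/-- `sin πϑ > 0` for `0 < w`, `π²w² ≤ 2`. [folklore] -/
theorem sin_pi_mul_ahTheta_pos {w : ℝ} (hw0 : 0 < w) (hw : π ^ 2 * w ^ 2 ≤ 2) :
    0 < Real.sin (π * ahTheta w) := by
  have h1 := ahTheta_pos hw0
  have h2 := ahTheta_le_half hw
  apply Real.sin_pos_of_pos_of_lt_pi
  · positivity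
  · calc π * ahTheta w ≤ π * (1 / 2) := mul_le_mul_of_nonneg_left h2 Real.pi_pos.le
      _ < π := by linarith [Real.pi_pos]

/-- **Cor. 3.6 for `D_n(e₁)`, exact division-free form** (`n ≥ 1`, `X = X^ϑ`):
`D_n(e₁) · ∏_{l<n} sin π(X_l + Φ(X_l, B_{l+1})) = sin πX_n · ∏_{1 ≤ l < n} sin πX_l`, i.e.
`D_n(e₁) = Γ^ϑ_n sin πX^ϑ_n / sin π[ϑ + Φ(ϑ, B_1)]` whenever no factor vanishes
(`e₁ = u(ϑ)/sin πϑ`). [cite: AjankiHuveneers2011, Cor. 3.6 eq. (3.22)] -/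
theorem ahD_e₁_product_formula {w : ℝ} {B : ℕ → ℝ} (hw0 : 0 < w) (hw : π ^ 2 * w ^ 2 ≤ 2)
    (hwB : ∀ k, π * w / 2 * (1 + |B k|) < 1) {n : ℕ} (hn : 1 ≤ n) :
    ahD (ahDiag w B) 1 0 n *
        ∏ l ∈ Finset.range n, Real.sin (π * (ahPhase w (ahTheta w) B l +
          ahPhi w (ahPhase w (ahTheta w) B l) (B l))) =
      Real.sin (π * ahPhase w (ahTheta w) B n) *
        ∏ l ∈ Finset.Ico 1 n, Real.sin (π * ahPhase w (ahTheta w) B l) := by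
  have h := (ahD_product_formula (x := ahTheta w) hw0.le hwB n).1
  rw [sub_self, mul_zero, Real.sin_zero, ahD_eq_lin, zero_mul, add_zero] at h
  have hs := sin_pi_mul_ahTheta_pos hw0 hw
  have hP : ∏ l ∈ Finset.range n, Real.sin (π * ahPhase w (ahTheta w) B l) =
      Real.sin (π * ahTheta w) * ∏ l ∈ Finset.Ico 1 n, Real.sin (π * ahPhase w (ahTheta w) B l) := by
    rw [Finset.range_eq_Ico, Finset.prod_eq_prod_Ico_succ_bot (show 0 < n by omega)]
    rfl
  rw [hP] at h
  have h' : Real.sin (π * ahTheta w) * (ahD (ahDiag w B) 1 0 n *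
      ∏ l ∈ Finset.range n, Real.sin (π * (ahPhase w (ahTheta w) B l +
        ahPhi w (ahPhase w (ahTheta w) B l) (B l)))) =
      Real.sin (π * ahTheta w) * (Real.sin (π * ahPhase w (ahTheta w) B n) *
        ∏ l ∈ Finset.Ico 1 n, Real.sin (π * ahPhase w (ahTheta w) B l)) := by
    linear_combination h
  exact mul_left_cancel₀ hs.ne' h'

/-! ### `ϑ(w) = w + 𝒪(w³)` and the shift identities behind `D_n(e₂)` -/

/-- `ϑ(w) ≥ w` (`cos y ≥ 1 - y²/2`). [cite: AjankiHuveneers2011, Lemma 3.1 eq. (3.4)] -/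
theorem ahTheta_ge {w : ℝ} (hw0 : 0 ≤ w) (hw : π * w ≤ 2) : w ≤ ahTheta w := by
  set a := π ^ 2 * w ^ 2 / 2 with ha
  set y := Real.arccos (1 - a) with hy
  have hy_eq : π * ahTheta w = y := pi_mul_ahTheta w
  have hπw : 0 ≤ π * w := mul_nonneg Real.pi_pos.le hw0
  have hcos : Real.cos y = 1 - a :=
    Real.cos_arccos (by rw [ha]; nlinarith [mul_le_mul hw hw hπw zero_le_two])
      (by rw [ha]; nlinarith [sq_nonneg (π * w)])
  have hy0 : 0 ≤ y := Real.arccos_nonneg _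
  have h1 := Real.one_sub_sq_div_two_le_cos (x := y)
  rw [hcos] at h1
  have h2 : (π * w) ^ 2 ≤ y ^ 2 := by rw [ha] at h1; nlinarith
  have h3 : π * w ≤ y := (sq_le_sq₀ hπw hy0).mp h2
  rw [← hy_eq] at h3
  exact le_of_mul_le_mul_left h3 Real.pi_pos

/-- `ϑ(w) ≤ w + w³` for `0 ≤ w ≤ 1/5` (the printed `ϑ = w + 𝒪(w³)`, from
`|cos y - (1 - y²/2)| ≤ (5/96)y⁴`). [cite: AjankiHuveneers2011, Lemma 3.1 eq. (3.4)] -/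
theorem ahTheta_le {w : ℝ} (hw0 : 0 ≤ w) (hw : w ≤ 1 / 5) : ahTheta w ≤ w + w ^ 3 := by
  set a := π ^ 2 * w ^ 2 / 2 with ha
  have hπ := Real.pi_lt_d2
  have hπ0 := Real.pi_pos
  have ha0 : 0 ≤ a := by positivity
  have hw2 : w ^ 2 ≤ 1 / 25 := by nlinarith
  have ha1 : a ≤ 1 / 5 := by
    rw [ha]
    nlinarith [mul_le_mul (show π ^ 2 ≤ 3.15 ^ 2 by nlinarith) hw2 (sq_nonneg w) (by norm_num)]
  set y := Real.arccos (1 - a) with hy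
  have hy_eq : π * ahTheta w = y := pi_mul_ahTheta w
  have hcos : Real.cos y = 1 - a := Real.cos_arccos (by linarith) (by linarith)
  have hy1 : y ≤ 1 := by
    calc y ≤ Real.arccos (Real.cos 1) := Real.arccos_le_arccos (by linarith [Real.cos_one_le])
      _ = 1 := Real.arccos_cos zero_le_one (by linarith [Real.pi_gt_three])
  have hy0 : 0 ≤ y := Real.arccos_nonneg _
  have hb := Real.cos_bound (show |y| ≤ 1 by rwa [abs_of_nonneg hy0])
  rw [hcos, abs_of_nonneg hy0] at hb
  have h1 : y ^ 2 / 2 - a ≤ y ^ 4 * (5 / 96) := by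
    have := (abs_le.mp hb).2
    linarith
  have hy4 : y ^ 4 ≤ y ^ 2 := by nlinarith [mul_le_mul hy1 hy1 hy0 zero_le_one, sq_nonneg y]
  have hcr : y ^ 2 ≤ 96 / 43 * a := by nlinarith
  have hy4' : y ^ 4 ≤ (96 / 43 * a) ^ 2 := by
    have : y ^ 4 = (y ^ 2) ^ 2 := by ring
    rw [this]
    exact pow_le_pow_left₀ (sq_nonneg y) hcr 2
  have href : y ^ 2 ≤ 2 * a + 5 / 48 * (96 / 43) ^ 2 * a ^ 2 := by nlinarith
  have htarget : y ≤ π * (w + w ^ 3) := by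
    have hπ2 : π ^ 2 ≤ 10 := by nlinarith
    have hw4 : 0 ≤ π ^ 2 * w ^ 4 := by positivity
    have hkey : 5 / 48 * (96 / 43) ^ 2 * (π ^ 2 * w ^ 2 / 2) ^ 2 ≤ 2 * (π ^ 2 * w ^ 4) := by
      have : 5 / 48 * (96 / 43) ^ 2 * (π ^ 2 * w ^ 2 / 2) ^ 2 =
          (5 / 48 * (96 / 43) ^ 2 / 4) * π ^ 2 * (π ^ 2 * w ^ 4) := by ring
      rw [this]
      nlinarith [mul_le_mul_of_nonneg_right hπ2 hw4]
    have hsq : y ^ 2 ≤ (π * (w + w ^ 3)) ^ 2 := by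
      rw [ha] at href
      nlinarith [hkey, mul_nonneg (sq_nonneg π) (pow_nonneg hw0 6)]
    exact (sq_le_sq₀ hy0 (by positivity)).mp hsq
  rw [← hy_eq] at htarget
  exact le_of_mul_le_mul_left htarget Real.pi_pos

/-- `Φ(0, b) = 0` ("since `Φ(0,b) = 0` it follows that `X^0_1 = ϑ` regardless of the value of `B_1`").
[cite: AjankiHuveneers2011, proof of Cor. 3.6] -/
theorem ahPhi_zero_left (w b : ℝ) : ahPhi w 0 b = 0 := by
  simp [ahPhi, ahNum]

/-- `X^0_{l+1} = θ_* X^ϑ_l`: the chain started at `0` is, after one step, the chain started at `ϑ`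
driven by the shifted disorder. [cite: AjankiHuveneers2011, proof of Cor. 3.6] -/
theorem ahPhase_zero_succ (w : ℝ) (B : ℕ → ℝ) :
    ∀ l, ahPhase w 0 B (l + 1) = ahPhase w (ahTheta w) (fun k => B (k + 1)) l
  | 0 => by simp [ahPhase_succ, ahStep, ahPhi_zero_left]
  | l + 1 => by rw [ahPhase_succ, ahPhase_zero_succ w B l, ahPhase_succ]

/-- `D_{n+1}(e₂) = -θ_* D_n(e₁)` ("`[D_1(e₂) D_0(e₂)]ᵀ = -e₁` and `D_n(-v) = -D_n(v)`").
[cite: AjankiHuveneers2011, proof of Cor. 3.6 eq. (3.24)] -/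
theorem ahD_e₂_eq_neg_shift (d : ℕ → ℝ) :
    ∀ n, ahD d 0 1 (n + 1) = -ahD (fun k => d (k + 1)) 1 0 n
  | 0 => by simp
  | 1 => by simp [ahD_add_two]
  | n + 2 => by
    rw [ahD_add_two, ahD_e₂_eq_neg_shift d (n + 1), ahD_e₂_eq_neg_shift d n]
    have : ahD (fun k => d (k + 1)) 1 0 (n + 2) =
        d (n + 2) * ahD (fun k => d (k + 1)) 1 0 (n + 1) - ahD (fun k => d (k + 1)) 1 0 n := rfl
    rw [this]
    ring

/-- **Cor. 3.6 for `D_n(e₂)`, exact division-free form** (`n ≥ 2`, `X = X^0`):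
`-D_n(e₂) · ∏_{1 ≤ l < n} sin π(X_l + Φ(X_l, B_{l+1})) = sin πX_n · ∏_{2 ≤ l < n} sin πX_l`, i.e.
`D_n(e₂) = -Γ^0_n sin πX^0_n / sin πϑ` whenever no factor vanishes (the paper's display (3.23)
prints `Γ^0_n sin πX^0_n / sin π[ϑ + Φ(ϑ,B_2)]`: no sign, and a denominator `= sin πϑ(1+𝒪(w))`;
see the module docstring). [cite: AjankiHuveneers2011, Cor. 3.6 eqs. (3.23)-(3.25)] -/
theorem ahD_e₂_product_formula {w : ℝ} {B : ℕ → ℝ} (hw0 : 0 < w) (hw : π ^ 2 * w ^ 2 ≤ 2)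
    (hwB : ∀ k, π * w / 2 * (1 + |B k|) < 1) {n : ℕ} (hn : 1 ≤ n) :
    -ahD (ahDiag w B) 0 1 (n + 1) *
        ∏ l ∈ Finset.Ico 1 (n + 1), Real.sin (π * (ahPhase w 0 B l +
          ahPhi w (ahPhase w 0 B l) (B l))) =
      Real.sin (π * ahPhase w 0 B (n + 1)) *
        ∏ l ∈ Finset.Ico 2 (n + 1), Real.sin (π * ahPhase w 0 B l) := by
  have hshift : (fun k => ahDiag w B (k + 1)) = ahDiag w (fun k => B (k + 1)) := by
    funext k; rfl
  rw [ahD_e₂_eq_neg_shift, neg_neg, hshift]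
  have h := ahD_e₁_product_formula (B := fun k => B (k + 1)) hw0 hw (fun k => hwB (k + 1)) hn
  simp only [← ahPhase_zero_succ w B] at h
  rw [Finset.range_eq_Ico, Finset.prod_Ico_add' (fun l => Real.sin (π * (ahPhase w 0 B l +
      ahPhi w (ahPhase w 0 B l) (B l)))), Finset.prod_Ico_add' (fun l =>
      Real.sin (π * ahPhase w 0 B l))] at h
  simpa using h

/-! ### The reduced law of the masses -/

/-- The standing hypothesis of AH2011 §2 on the law of the reduced masses
`B_k = (M_k - 𝔼M)/𝔼M`: i.i.d., zero mean, with a probability density `τ` vanishing off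
`[b₋, b₊]`, `-1 < b₋ < b₊ < ∞`, `τ ∈ C¹([b₋, b₊])` ("continuous on `[b₋,b₊]`, derivatives bounded
and continuous on `]b₋,b₊[`"). [cite: AjankiHuveneers2011, §2 (¶1 and eq. (2.1))] -/
structure ReducedLawHyp (τ : ℝ → ℝ) (bm bp : ℝ) : Prop where
  /-- the masses are positive: `B > -1` -/
  lo : -1 < bm
  /-- non-degenerate support -/
  lt : bm < bp
  /-- `τ ≥ 0` -/
  nonneg : ∀ s, 0 ≤ τ s
  /-- `τ` vanishes off `[b₋, b₊]` -/
  eq_zero : ∀ s ∉ Set.Icc bm bp, τ s = 0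
  /-- `τ` is continuous on `[b₋, b₊]` -/
  continuousOn : ContinuousOn τ (Set.Icc bm bp)
  /-- `τ` is `C¹` inside its support -/
  contDiffOn : ContDiffOn ℝ 1 τ (Set.Ioo bm bp)
  /-- with a uniformly bounded derivative -/
  deriv_bound : ∃ C : ℝ, ∀ s ∈ Set.Ioo bm bp, |deriv τ s| ≤ C
  /-- `τ` is a probability density -/
  integral_eq_one : ∫ s, τ s = 1
  /-- zero mean: `𝔼 B = 0` -/
  mean_zero : ∫ s, s * τ s = 0

end Literature.Barriers.AtomisticToContinuum.HeatConduction

namespace Literature.Barriers.AtomisticToContinuum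

open Literature.MathematicalPhysics.KineticTheory.HeatConduction HeatConduction

/-! ### Named facts of §3–§5 feeding the bounds (U) and (L) -/

/-- **Lemma 3.2, the expansion (3.11) of `Φ`**: "`Φ(x,b) = sin²(πx)[wb + w²b²(π/2) sin(2πx) +
w³ b R₃(w,x,b)]`. The remainder term `R₃ : [0,w₀] × 𝕋 × [b₋,b₊] → ℝ` is a smooth and bounded
function" — vendored as the bound it is used for: for `-1 < b₋ < b₊` there are `w₀ > 0` and `C`
with `|Φ(x,b) - sin²(πx)(wb + w²b²(π/2)sin 2πx)| ≤ C w³ |b| sin²(πx)` for `0 < w ≤ w₀`, all `x`,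
`b ∈ [b₋, b₊]` (boundedness of `R₃`; smoothness not asserted). Proof in the paper: Appendix 7.1,
"a mechanical calculation". [cite: AjankiHuveneers2011, Lemma 3.2 eq. (3.11)] -/
def AjankiHuveneers2011_PhiExpansion : Prop :=
  ∀ bm bp : ℝ, -1 < bm → bm < bp →
    ∃ w₀ : ℝ, 0 < w₀ ∧ ∃ C : ℝ, ∀ w ∈ Set.Ioc 0 w₀, ∀ x : ℝ, ∀ b ∈ Set.Icc bm bp,
      |ahPhi w x b - Real.sin (π * x) ^ 2 * (w * b + w ^ 2 * b ^ 2 * (π / 2) * Real.sin (2 * π * x))|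
        ≤ C * w ^ 3 * |b| * Real.sin (π * x) ^ 2

/-- **Cor. 3.4 (i), uniform monotonicity of the phase**: "`0 < (1+b₋)w + 𝒪(w²) ≤ ΔX_k ≤
(1+b₊)w + 𝒪(w²)`", i.e. for the lifted one-step map `f_b(x) = x + ϑ + Φ(x,b)`: there are `w₀ > 0`
and `C` such that `0 < f_b(x) - x` and `(1+b₋)w - Cw² ≤ f_b(x) - x ≤ (1+b₊)w + Cw²` for
`0 < w ≤ w₀`, all `x` and `b ∈ [b₋, b₊]`; here `-1 < b₋ ≤ 0 ≤ b₊` (zero-mean reduced masses).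
From (3.15): `f_b(x) = x + w + wφ(x)b + w²ψ(x)b² + 𝒪(w³)`, `φ = sin²(π·) ∈ [0,1]`.
[cite: AjankiHuveneers2011, Cor. 3.4 (i) with eqs. (3.15)-(3.16)] -/
def AjankiHuveneers2011_phaseMonotone : Prop :=
  ∀ bm bp : ℝ, -1 < bm → bm ≤ 0 → 0 ≤ bp →
    ∃ w₀ : ℝ, 0 < w₀ ∧ ∃ C : ℝ, ∀ w ∈ Set.Ioc 0 w₀, ∀ x : ℝ, ∀ b ∈ Set.Icc bm bp,
      0 < ahStep w b x - x ∧ (1 + bm) * w - C * w ^ 2 ≤ ahStep w b x - x ∧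
        ahStep w b x - x ≤ (1 + bp) * w + C * w ^ 2

/-- **Prop. 3.5, the exponential representation (3.21) of the amplitude**: "`Γ^x_n =
exp[w∑_{l=1}^n s(X^x_{l-1})B_l + w²∑_{l=1}^n r(X^x_{l-1})B_l² + 𝒪(w³n)]`" with
`s(x) = -(π/2) sin 2πx`, `r(x) = (π²/4)(cos² 2πx - cos 2πx)` (from (3.19):
`sin πx / sin π(x + Φ(x,b)) = exp[-w(π/2) sin(2πx) b + w²(π/2)²(cos²2πx - cos 2πx)b² + 𝒪(w³)]`
factor by factor). Vendored for `Γ^x_n = ∏_{l=1}^{n-1} sin πX_l / sin π(X_l + Φ(X_l, B_{l+1}))`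
exactly as in (3.14), whose expansion is the sum over the SAME factors `l = 1, …, n-1` (the
paper's display also lists the term `l = 1`, i.e. `ws(x)B_1 + w²r(x)B_1²`, which is not a factor of
(3.14); it is `𝒪(w)`, vanishes for `x = 0` and is `𝒪(w²)` for `x = ϑ`, and is absorbed in the
constants downstream — cf. the "missing first terms" in the proof of Cor. 3.6): for
`-1 < b₋ < b₊` there are `w₀ > 0`, `C` with `Γ^x_n > 0` and
`|log Γ^x_n - ∑_{l=1}^{n-1} (w s(X_l) B_{l+1} + w² r(X_l) B_{l+1}²)| ≤ C w³ n` for `0 < w ≤ w₀`, all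
`x`, all `B ∈ [b₋, b₊]^ℕ`, all `n`. (Indexing: `B l` below is `B_{l+1}`.)
[cite: AjankiHuveneers2011, Prop. 3.5 eqs. (3.19)-(3.21)] -/
def AjankiHuveneers2011_logGammaExpansion : Prop :=
  ∀ bm bp : ℝ, -1 < bm → bm < bp →
    ∃ w₀ : ℝ, 0 < w₀ ∧ ∃ C : ℝ, ∀ w ∈ Set.Ioc 0 w₀, ∀ x : ℝ, ∀ B : ℕ → ℝ,
      (∀ k, B k ∈ Set.Icc bm bp) → ∀ n : ℕ,
        0 < ahGamma w x B n ∧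
          |Real.log (ahGamma w x B n) - ∑ l ∈ Finset.Ico 1 n,
              (w * ahS (ahPhase w x B l) * B l + w ^ 2 * ahR (ahPhase w x B l) * B l ^ 2)|
            ≤ C * w ^ 3 * n

/-- **Prop. 4.1, the expectation of `1/Γ_n` decays exponentially**: "For sufficiently small
`w₀ ∼ 1` there exists `α ≡ α(w₀) > 0` such that for `n ∈ ℕ`, `sup_{x ∈ 𝕋} 𝔼(1/Γ^x_n) ≲ e^{-αw²n}`,
`w ∈ ]0,w₀]`" (constants depending on the reduced law `τ`; Freedman's and Azuma's exponential
martingale bounds, Lemma 4.2, and the noisy `L^p`-ergodicity over one round, Lemma 4.4).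
Expectation over `(B_1, …, B_n) ∼ τ^{⊗n}`; finiteness of the expectation is part of the claim.
[cite: AjankiHuveneers2011, Prop. 4.1 eq. (4.1)] -/
def AjankiHuveneers2011_invGammaDecay : Prop :=
  ∀ (τ : ℝ → ℝ) (bm bp : ℝ), ReducedLawHyp τ bm bp →
    ∀ (ρB : Measure ℝ) [IsProbabilityMeasure ρB],
      ρB = volume.withDensity (fun s => ENNReal.ofReal (τ s)) →
      ∃ w₀ : ℝ, 0 < w₀ ∧ ∃ α : ℝ, 0 < α ∧ ∃ C : ℝ, ∀ w ∈ Set.Ioc 0 w₀, ∀ n : ℕ, ∀ x : ℝ,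
        Integrable (fun B : Fin n → ℝ => (ahGamma w x (finExt B) n)⁻¹)
            (Measure.pi fun _ : Fin n => ρB) ∧
          ∫ B, (ahGamma w x (finExt B) n)⁻¹ ∂(Measure.pi fun _ : Fin n => ρB) ≤
            C * Real.exp (-(α * w ^ 2 * n))

/-- **Prop. 5.1, potential theory for the phase chain**: "Let `κ > 0`, and let `h ∈ C¹(𝕋)`.
There exist `K, K', w₀ > 0` such that, for every `w ∈ ]0,w₀]`, for every function
`u ∈ L¹(𝕋; ℝ₊)`, for every `x ∈ ℝ`, and for every `n ∈ ℕ`, one has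
`𝔼(e^{w∑_{k=1}^n h(X^x_{k-1})B_k} u(X^x_n)) ≤ (K/(w√n)) ∫_𝕋 u(y) dy` (`wn ≥ κ`, `w²n ≤ 1`), and
`𝔼(e^{w∑_{k=1}^n h(X^x_{k-1})B_k} u(X^x_n)) ≥ K' ∫_𝕋 u(y) dy` (`1/2 ≤ w²n ≤ 1`)" (constants
depending on `κ`, `h` and the reduced law). Here `h, u : ℝ → ℝ` are `1`-periodic (functions on
`𝕋`), `X^x` is the lifted chain `ahPhase`, `∫_𝕋 u = ∫_{[0,1)} u`, the expectation is over
`(B_1,…,B_n) ∼ τ^{⊗n}`, and finiteness of the expectations in the two regimes is part of the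
claim. [cite: AjankiHuveneers2011, Prop. 5.1 eqs. (5.1)-(5.2)] -/
def AjankiHuveneers2011_potentialTheory : Prop :=
  ∀ (τ : ℝ → ℝ) (bm bp : ℝ), ReducedLawHyp τ bm bp →
    ∀ (ρB : Measure ℝ) [IsProbabilityMeasure ρB],
      ρB = volume.withDensity (fun s => ENNReal.ofReal (τ s)) →
      ∀ κ : ℝ, 0 < κ → ∀ h : ℝ → ℝ, Function.Periodic h 1 → ContDiff ℝ 1 h →
        ∃ K K' w₀ : ℝ, 0 < K ∧ 0 < K' ∧ 0 < w₀ ∧ ∀ w ∈ Set.Ioc 0 w₀,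
          ∀ u : ℝ → ℝ, Function.Periodic u 1 → (∀ y, 0 ≤ u y) → IntegrableOn u (Set.Ico 0 1) →
            ∀ x : ℝ, ∀ n : ℕ,
              (κ ≤ w * n → w ^ 2 * n ≤ 1 →
                Integrable (fun B : Fin n → ℝ =>
                    Real.exp (w * ∑ k ∈ Finset.range n, h (ahPhase w x (finExt B) k) * finExt B k) *
                      u (ahPhase w x (finExt B) n)) (Measure.pi fun _ : Fin n => ρB) ∧
                ∫ B, Real.exp (w * ∑ k ∈ Finset.range n, h (ahPhase w x (finExt B) k) * finExt B k) *
                    u (ahPhase w x (finExt B) n) ∂(Measure.pi fun _ : Fin n => ρB) ≤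
                  K / (w * Real.sqrt n) * ∫ y in Set.Ico 0 1, u y) ∧
              (1 / 2 ≤ w ^ 2 * n → w ^ 2 * n ≤ 1 →
                Integrable (fun B : Fin n → ℝ =>
                    Real.exp (w * ∑ k ∈ Finset.range n, h (ahPhase w x (finExt B) k) * finExt B k) *
                      u (ahPhase w x (finExt B) n)) (Measure.pi fun _ : Fin n => ρB) ∧
                K' * ∫ y in Set.Ico 0 1, u y ≤
                  ∫ B, Real.exp (w * ∑ k ∈ Finset.range n, h (ahPhase w x (finExt B) k) * finExt B k) *
                    u (ahPhase w x (finExt B) n) ∂(Measure.pi fun _ : Fin n => ρB))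

end Literature.Barriers.AtomisticToContinuum

end
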